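import Literature.NumberTheory.EllipticCurves.BhargavaShankarRegionGeometry
import Literature.NumberTheory.EllipticCurves.BhargavaShankarCoefficientBoxes
import Literature.Algebra.EuclideanLattices.AnisotropicLatticePointCounting
import Mathlib.MeasureTheory.Measure.Lebesgue.EqHaar
import HarnessLib

/-!
# The lattice-point count of the regions `S_g = g · B(𝓛_X)` (Bhargava–Shankar §2.3, in place of
# Davenport's lemma)

Topic `Literature/NumberTheory/EllipticCurves`; combines `BhargavaShankarRegionGeometry.lean`
(Lipschitz patches covering `frontier Ψ(box)`), `BhargavaShankarCoefficientBoxes.lean` (`regionS`,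
`C₁`, the anisotropic coefficient box) and the anisotropic cube count
`Literature.Algebra.EuclideanLattices.abs_ncard_sub_volume_le_of_forall_patch`. Everything here is
PROVED (no named facts).

Bhargava–Shankar (`arXiv:1006.1002v2`, §2.3, Prop. 2.6 and displays (12)–(13)) estimate the
number of lattice points in `B(n,t,λ,X) = n a(t) k λ G₀ L` by Davenport's lemma: the volume plus
an error bounded by the volumes of the projections, `O(λ¹⁶ t² + …)`. Here:

* `Piece`, `sections D X = 𝓛_X = {m · c_k(τ) : 0 < m < X^{1/6}, τ ∈ T_k}`, the normalised region
  `B1set D = ⋃_k Ψ_k(box_k)` and the linear map `linT g X = X^{1/6} A(g)`; **`S_g = linT(B₁)`**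
  (`regionS_sections_eq`, homogeneity of `Ψ` in `m`); `B₁` is bounded and measurable,
  `vol(S_g) = X^{5/6} vol(B₁)` (`det A(g) = (det g)^{10} = 1`), `frontier S_g = linT(frontier B₁)`
  is covered by the `10K` patches `linT ∘ Ψ_k ∘ face` (`frontier_regionS_subset`);
* the patches are coordinatewise Lipschitz with constants `Λ · (y², y, 1, y⁻¹, y⁻²)`,
  `Λ = 20 C₁ L X^{1/6}` (`patch_lipschitz`: `A(g) = A(a(√y)) A(ñ(x/y) k(θ))` with
  `A(a(s)) = diag(s⁴, s², 1, s⁻², s⁻⁴)` and `|A(γ₀)_{il}| ≤ C₁`);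
* **`abs_latticeCount_sub_le`**: for `X ≥ 1`, `|x| ≤ ½`, `y ≥ √3/2` and `Λ y⁻² ≥ 1` (main body),
  `|#{z ∈ ℤ⁵ ∩ S_g} − X^{5/6} vol(B₁)| ≤ 576000 K Λ⁴ y²` — an error `≪ X^{2/3} y²`, which
  integrates to `O(X^{3/4})` over the main body of Gauss's fundamental domain.

## References

* M. Bhargava, A. Shankar, Ann. of Math. (2) 181 (2015) 191–242, §2.3 (Prop. 2.6,
  displays (12)–(13)); arXiv:1006.1002v2 numbering. [cite: BhargavaShankarAnnals2015, §2.3 (Prop. 2.6, displays (12)–(13); arXiv:1006.1002v2 numbering)]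
* H. Davenport, *On a principle of Lipschitz*, J. London Math. Soc. 26 (1951) 179–183 (replaced
  here by the Lipschitz cube count). [cite: Davenport1951, Theorem (principle of Lipschitz)]
-/

noncomputable section

open Real MeasureTheory Matrix Set Filter Topology
open scoped MatrixGroups Pointwise

namespace Literature.NumberTheory.EllipticCurves

namespace BinaryQuartic

open Literature.MeasureTheory.Group Literature.Algebra.EuclideanLattices

/-! ## Pieces of a fundamental set and the sections `𝓛_X` -/

/-- A piece of a fundamental set: a cone over a `C¹` curve of forms with small coefficients and
nonzero discriminant, with a parameter set `(t₁, t₂) ⊆ T ⊆ [t₁, t₂]` on which the cone points are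
determined by their invariants and the Jacobian factor does not vanish on `(t₁, t₂)`. [folklore] -/
structure Piece where
  /-- the curve -/
  C : SmoothCurve
  /-- left end of the parameter interval -/
  t₁ : ℝ
  /-- right end -/
  t₂ : ℝ
  /-- the parameter set -/
  T : Set ℝ
  /-- the interval is nonempty -/
  ht : t₁ ≤ t₂
  /-- and of length `≤ 4` -/
  ht4 : t₂ - t₁ ≤ 4
  /-- `(t₁, t₂) ⊆ T` -/
  hT₁ : Set.Ioo t₁ t₂ ⊆ T
  /-- `T ⊆ [t₁, t₂]` -/
  hT₂ : T ⊆ Set.Icc t₁ t₂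
  /-- `T` is measurable -/
  hTm : MeasurableSet T
  /-- the Jacobian factor does not vanish inside -/
  hι : ∀ τ ∈ Set.Ioo t₁ t₂, C.iota τ ≠ 0
  /-- the curve has coefficients `≤ 1` -/
  hcoef : ∀ τ ∈ T, ∀ l, |(C.c τ).coeffs l| ≤ 1
  /-- nonzero discriminant -/
  hΔ : ∀ τ ∈ T, (C.c τ).disc ≠ 0
  /-- cone points are determined by their invariants -/
  huniq : ∀ m m' τ τ' : ℝ, 0 < m → 0 < m' → τ ∈ T → τ' ∈ T →
    (m • C.c τ).I = (m' • C.c τ').I → (m • C.c τ).J = (m' • C.c τ').J → m = m' ∧ τ = τ'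

variable {K : ℕ} (D : Fin K → Piece)

/-- The sections of height `< X`: `𝓛_X = {m · c_k(τ) : 0 < m < X^{1/6}, τ ∈ T_k}`. [cite: BhargavaShankarAnnals2015, §2.1 and §2.3 (L_V^{(i)}, R_X; arXiv:1006.1002v2 numbering)] -/
def sections (X : ℝ) : Set (BinaryQuartic ℝ) :=
  {ℓ | ∃ k : Fin K, ∃ m τ : ℝ, 0 < m ∧ m < X ^ (1 / 6 : ℝ) ∧ τ ∈ (D k).T ∧ ℓ = m • (D k).C.c τ}

/-- The normalised region `B₁ = ⋃_k Ψ_k(box_k) ⊂ ℝ⁵` (coefficient vectors of `G₀⁻¹ · 𝓛_1`). [folklore] -/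
def B1set : Set (Fin 5 → ℝ) := ⋃ k : Fin K, psi (D k).C.cone '' paramBox (D k).T

/-- The linear map `v ↦ X^{1/6} · A(g) v` carrying `B₁` to `S_g`. [folklore] -/
def linT (g : Matrix (Fin 2) (Fin 2) ℝ) (X : ℝ) : (Fin 5 → ℝ) →ₗ[ℝ] (Fin 5 → ℝ) :=
  X ^ (1 / 6 : ℝ) • Matrix.toLin' (actionMatrix g)

/-- `linT g X v = X^{1/6} • A(g) v`. [folklore] -/
theorem linT_apply (g : Matrix (Fin 2) (Fin 2) ℝ) (X : ℝ) (v : Fin 5 → ℝ) :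
    linT g X v = X ^ (1 / 6 : ℝ) • (actionMatrix g *ᵥ v) := by
  simp [linT, Matrix.toLin'_apply]

/-- Coefficients of the forms of `𝓛_X` are `≤ X^{1/6}`. [folklore] -/
theorem sections_coeff_le {X : ℝ} (hX : 0 ≤ X) {ℓ : BinaryQuartic ℝ} (hℓ : ℓ ∈ sections D X) (l : Fin 5) :
    |ℓ.coeffs l| ≤ X ^ (1 / 6 : ℝ) := by
  obtain ⟨k, m, τ, hm, hmX, hτ, rfl⟩ := hℓ
  rw [coeffs_smul', Pi.smul_apply, smul_eq_mul, abs_mul, abs_of_pos hm]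
  calc m * |(D k).C.c τ |>.coeffs l| ≤ X ^ (1 / 6 : ℝ) * 1 :=
        mul_le_mul hmX.le ((D k).hcoef τ hτ l) (abs_nonneg _) (Real.rpow_nonneg hX _)
    _ = X ^ (1 / 6 : ℝ) := mul_one _

/-- `Ψ` is homogeneous of degree `1` in `m`: `Ψ(x,y,θ, c·m, τ) = c · Ψ(x,y,θ,m,τ)`. [folklore] -/
theorem psi_smul_m (C : SmoothCurve) (p : Fin 5 → ℝ) (c : ℝ) :
    psi C.cone (Function.update p 3 (c * p 3)) = c • psi C.cone p := by
  simp only [psi, SmoothCurve.cone, Function.update_self, Function.update_of_ne (by decide : (4 : Fin 5) ≠ 3),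
    Function.update_of_ne (by decide : (0 : Fin 5) ≠ 3), Function.update_of_ne (by decide : (1 : Fin 5) ≠ 3),
    Function.update_of_ne (by decide : (2 : Fin 5) ≠ 3)]
  rw [mul_smul, smul_subst, coeffs_smul']

/-- **`S_g = X^{1/6} · A(g) · B₁`** (as a set of coefficient vectors), for `det g = 1`-type use:
`regionS (𝓛_X) g = linT g X '' B₁`. [cite: BhargavaShankarAnnals2015, §2.3 (B(n,t,λ,X) = n a(t) k λ G₀ L; arXiv:1006.1002v2 numbering)] -/
theorem regionS_sections_eq {X : ℝ} (hX : 0 < X) (g : Matrix (Fin 2) (Fin 2) ℝ) :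
    regionS (sections D X) g = linT g X '' B1set D := by
  have hX6 : 0 < X ^ (1 / 6 : ℝ) := Real.rpow_pos_of_pos hX _
  ext v
  constructor
  · rintro ⟨w, ⟨h', hh', ℓ, ⟨k, m, τ, hm, hmX, hτ, rfl⟩, rfl⟩, rfl⟩
    obtain ⟨x, y, θ, hx, hy, hθ, rfl⟩ := mem_G0_iff.1 hh'
    have hy0 : 0 < y := by have := (abs_lt.1 hy).1; norm_num [δ₀] at this ⊢; linarith
    -- the parameter point
    set p : Fin 5 → ℝ := ![x, y, θ, m / X ^ (1 / 6 : ℝ), τ] with hp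
    have hpbox : p ∈ paramBox (D k).T := by
      rw [mem_paramBox_iff]
      simp only [hp, Matrix.cons_val_zero, Matrix.cons_val_one, Matrix.cons_val, Fin.isValue]
      refine ⟨abs_lt.1 hx, ⟨by linarith [(abs_lt.1 hy).1], by linarith [(abs_lt.1 hy).2]⟩, hθ,
        ⟨div_pos hm hX6, (div_lt_one hX6).2 hmX⟩, hτ⟩
    refine ⟨psi (D k).C.cone p, Set.mem_iUnion.2 ⟨k, p, hpbox, rfl⟩, ?_⟩
    have h3 : X ^ (1 / 6 : ℝ) * p 3 = m := by
      simp only [hp, Matrix.cons_val, Fin.isValue]; field_simp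
    have key := psi_smul_m (D k).C p (X ^ (1 / 6 : ℝ))
    rw [linT_apply, coeffs_subst, ← iwasawaG_eq_inv x hy0 θ, ← Matrix.mulVec_smul, ← key]
    congr 1
    simp only [psi, SmoothCurve.cone, Function.update_self, h3,
      Function.update_of_ne (by decide : (4 : Fin 5) ≠ 3), Function.update_of_ne (by decide : (0 : Fin 5) ≠ 3),
      Function.update_of_ne (by decide : (1 : Fin 5) ≠ 3), Function.update_of_ne (by decide : (2 : Fin 5) ≠ 3)]
    simp [hp]
  · rintro ⟨u, hu, rfl⟩
    obtain ⟨k, p, hp, rfl⟩ := Set.mem_iUnion.1 hu |>.imp fun k h => h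
    obtain ⟨h0, h1, h2, h3, h4⟩ := mem_paramBox_iff.1 hp
    have hy0 : 0 < p 1 := paramBox_subset _ hp
    -- the section `ℓ = (X^{1/6} p₃) • c(p₄)` and `h' = ñ a k`
    refine ⟨((X ^ (1 / 6 : ℝ) * p 3) • (D k).C.c (p 4)).subst (iwasawaGinv (p 0) (p 1) (p 2))⁻¹,
      ⟨iwasawaGinv (p 0) (p 1) (p 2), iwasawaGinv_mem_G0 hp, _, ⟨k, X ^ (1 / 6 : ℝ) * p 3, p 4,
        mul_pos hX6 h3.1, by nlinarith [h3.2], h4, rfl⟩, rfl⟩, ?_⟩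
    have key := psi_smul_m (D k).C p (X ^ (1 / 6 : ℝ))
    rw [linT_apply, coeffs_subst, ← iwasawaG_eq_inv (p 0) hy0 (p 2), ← Matrix.mulVec_smul, ← key]
    rfl

/-! ## Boundedness, measurability and volume -/

/-- `Ψ(box)` is bounded (it lies in the continuous image of the compact `[lo, up]`). [folklore] -/
theorem isBounded_psi_image (P : Piece) : Bornology.IsBounded (psi P.C.cone '' paramBox P.T) := by
  have hcont : ContinuousOn (psi P.C.cone) (Set.Icc (boxLo P.t₁) (boxUp P.t₂)) := fun p hp =>
    (contDiffAt_psi p (Icc_box_subset_pos _ _ hp)).continuousAt.continuousWithinAt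
  exact ((isCompact_Icc.image_of_continuousOn hcont).isBounded).subset
    (Set.image_mono (paramBox_subset_Icc P.hT₂))

/-- `B₁` is bounded. [folklore] -/
theorem isBounded_B1set : Bornology.IsBounded (B1set D) :=
  Bornology.isBounded_iUnion.2 fun k => isBounded_psi_image (D k)

/-- `Ψ(box)` is measurable (injective continuous image of a Borel set). [folklore] -/
theorem measurableSet_psi_image (P : Piece) : MeasurableSet (psi P.C.cone '' paramBox P.T) := by
  have hcont : ContinuousOn (psi P.C.cone) (paramBox P.T) := fun p hp =>
    (contDiffAt_psi p (paramBox_subset _ hp)).continuousAt.continuousWithinAt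
  exact (measurableSet_paramBox P.hTm).image_of_continuousOn_injOn hcont (injOn_psi_cone P.C P.hΔ P.huniq)

/-- `B₁` is measurable. [folklore] -/
theorem measurableSet_B1set : MeasurableSet (B1set D) :=
  MeasurableSet.iUnion fun k => measurableSet_psi_image (D k)

/-- `det (linT g X) = X^{5/6} (det g)^{10}`. [folklore] -/
theorem det_linT (g : Matrix (Fin 2) (Fin 2) ℝ) {X : ℝ} (hX : 0 ≤ X) :
    LinearMap.det (linT g X) = X ^ (5 / 6 : ℝ) * g.det ^ 10 := by
  rw [linT, LinearMap.det_smul, LinearMap.det_toLin', det_actionMatrix, Module.finrank_fin_fun]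
  congr 1
  rw [← Real.rpow_natCast, ← Real.rpow_mul hX]; norm_num

/-- **`vol(S_g) = X^{5/6} vol(B₁)`** for `det g = 1`. [folklore] -/
theorem volume_linT_image {g : Matrix (Fin 2) (Fin 2) ℝ} (hg : g.det = 1) {X : ℝ} (hX : 0 ≤ X) (s : Set (Fin 5 → ℝ)) :
    volume (linT g X '' s) = ENNReal.ofReal (X ^ (5 / 6 : ℝ)) * volume s := by
  rw [MeasureTheory.Measure.addHaar_image_linearMap, det_linT g hX, hg, one_pow, mul_one,
    abs_of_nonneg (Real.rpow_nonneg hX _)]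

/-! ## Frontier -/

/-- The frontier of a finite union is covered by the frontiers. [folklore] -/
theorem frontier_iUnion_subset {E : Type*} [TopologicalSpace E] {ι : Type*} [Finite ι] (s : ι → Set E) :
    frontier (⋃ i, s i) ⊆ ⋃ i, frontier (s i) := by
  intro v hv
  rw [frontier, closure_iUnion_of_finite, Set.mem_sdiff, Set.mem_iUnion] at hv
  obtain ⟨⟨i, hi⟩, hni⟩ := hv
  refine Set.mem_iUnion.2 ⟨i, hi, fun hint => hni ?_⟩
  exact interior_mono (Set.subset_iUnion s i) hint

/-- `linT g X` is a homeomorphism for `X > 0`, `det g ≠ 0`; hence it maps frontiers to frontiers.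
[folklore] -/
theorem frontier_linT_image {g : Matrix (Fin 2) (Fin 2) ℝ} (hg : g.det ≠ 0) {X : ℝ} (hX : 0 < X) (s : Set (Fin 5 → ℝ)) :
    frontier (linT g X '' s) = linT g X '' frontier s := by
  have hdet : LinearMap.det (linT g X) ≠ 0 := by
    rw [det_linT g hX.le]; exact mul_ne_zero (Real.rpow_pos_of_pos hX _).ne' (pow_ne_zero _ hg)
  set e : (Fin 5 → ℝ) ≃ₗ[ℝ] (Fin 5 → ℝ) := (linT g X).equivOfDetNeZero hdet with he
  have hcoe : ∀ v, e v = linT g X v := fun v => rfl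
  have h := e.toContinuousLinearEquiv.toHomeomorph.image_frontier s
  have hcoe' : ⇑(e.toContinuousLinearEquiv.toHomeomorph) = ⇑(linT g X) := by funext v; rfl
  rw [hcoe'] at h
  exact h.symm

/-! ## The patches -/

/-- The index set of the patches: piece, face coordinate, lower/upper face. [folklore] -/
abbrev PatchIdx (K : ℕ) := Fin K × Fin 5 × Bool

/-- The face value. [folklore] -/
def faceVal (P : Piece) (j : Fin 5) (b : Bool) : ℝ := if b then boxUp P.t₂ j else boxLo P.t₁ j

/-- The patch maps `[0,1]⁴ → ℝ⁵`: `s ↦ X^{1/6} A(g) Ψ_k(face_{j,±}(s))`. [folklore] -/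
def patch (g : Matrix (Fin 2) (Fin 2) ℝ) (X : ℝ) (idx : PatchIdx K) (s : Fin 4 → ℝ) : Fin 5 → ℝ :=
  linT g X (psi (D idx.1).C.cone (faceMap (boxLo (D idx.1).t₁) (boxUp (D idx.1).t₂) idx.2.1 (faceVal (D idx.1) idx.2.1 idx.2.2) s))

/-- **The frontier of `S_g` is covered by the patches.** [folklore] -/
theorem frontier_regionS_subset {X : ℝ} (hX : 0 < X) {g : Matrix (Fin 2) (Fin 2) ℝ} (hg : g.det ≠ 0) :
    frontier (regionS (sections D X) g) ⊆ ⋃ idx : PatchIdx K, patch D g X idx '' Set.Icc 0 1 := by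
  rw [regionS_sections_eq D hX, frontier_linT_image hg hX]
  rintro _ ⟨v, hv, rfl⟩
  obtain ⟨k, hk⟩ := Set.mem_iUnion.1 (frontier_iUnion_subset _ hv)
  have hP := D k
  obtain ⟨j, hj⟩ := Set.mem_iUnion.1
    (frontier_psi_image_subset (D k).C (D k).ht (D k).hT₁ (D k).hT₂ (D k).hι hk)
  rw [Set.mem_iUnion]
  rcases hj with ⟨s, hs, rfl⟩ | ⟨s, hs, rfl⟩
  · refine ⟨(k, j, false), s, hs, ?_⟩
    simp [patch, faceVal]
  · refine ⟨(k, j, true), s, hs, ?_⟩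
    simp [patch, faceVal]

/-! ## Lipschitz constants of the patches -/

/-- A Lipschitz constant of `Ψ_P` on `[lo, up]`. [folklore] -/
def Lk (P : Piece) : ℝ := (exists_lipschitz_psi P.C P.t₁ P.t₂).choose

/-- `Lk ≥ 0`. [folklore] -/
theorem Lk_nonneg (P : Piece) : 0 ≤ Lk P := (exists_lipschitz_psi P.C P.t₁ P.t₂).choose_spec.1

/-- The Lipschitz property of `Lk`. [folklore] -/
theorem Lk_spec (P : Piece) {p q : Fin 5 → ℝ} (hp : p ∈ Set.Icc (boxLo P.t₁) (boxUp P.t₂))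
    (hq : q ∈ Set.Icc (boxLo P.t₁) (boxUp P.t₂)) : ‖psi P.C.cone p - psi P.C.cone q‖ ≤ Lk P * ‖p - q‖ :=
  (exists_lipschitz_psi P.C P.t₁ P.t₂).choose_spec.2 p hp q hq

/-- A common Lipschitz constant `≥ 1` for all pieces. [folklore] -/
def Lmax : ℝ := 1 + ∑ k, Lk (D k)

/-- `Lmax ≥ 1`. [folklore] -/
theorem one_le_Lmax : 1 ≤ Lmax D := by
  unfold Lmax; have := Finset.sum_nonneg (fun k (_ : k ∈ Finset.univ) => Lk_nonneg (D k)); linarith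

/-- `Lk ≤ Lmax`. [folklore] -/
theorem Lk_le_Lmax (k : Fin K) : Lk (D k) ≤ Lmax D := by
  unfold Lmax
  have := Finset.single_le_sum (fun k (_ : k ∈ Finset.univ) => Lk_nonneg (D k)) (Finset.mem_univ k)
  linarith

/-- The face maps land in the closed box. [folklore] -/
theorem faceMap_mem_Icc (P : Piece) (j : Fin 5) (b : Bool) {s : Fin 4 → ℝ} (hs : s ∈ Set.Icc (0 : Fin 4 → ℝ) 1) :
    faceMap (boxLo P.t₁) (boxUp P.t₂) j (faceVal P j b) s ∈ Set.Icc (boxLo P.t₁) (boxUp P.t₂) := by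
  have hle := boxLo_le_boxUp P.ht
  constructor <;> intro i <;> rcases Fin.eq_self_or_eq_succAbove j i with rfl | ⟨k, rfl⟩
  · rw [faceMap_apply_same, faceVal]; split_ifs <;> [exact hle _; exact le_rfl]
  · rw [faceMap_apply_succAbove]
    have := hs.1 k; have := hs.2 k; simp only [Pi.zero_apply, Pi.one_apply] at *
    nlinarith [hle (j.succAbove k)]
  · rw [faceMap_apply_same, faceVal]; split_ifs <;> [exact le_rfl; exact hle _]
  · rw [faceMap_apply_succAbove]
    have := hs.1 k; have := hs.2 k; simp only [Pi.zero_apply, Pi.one_apply] at *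
    nlinarith [hle (j.succAbove k)]

/-- The action matrix of the diagonal part. [folklore] -/
theorem actionMatrix_diagTorus {s : ℝ} (hs : s ≠ 0) :
    actionMatrix (diagTorus s) = Matrix.diagonal ![s ^ 4, s ^ 2, 1, (s⁻¹) ^ 2, (s⁻¹) ^ 4] := by
  ext i j
  fin_cases i <;> fin_cases j <;> simp [actionMatrix, diagTorus, Matrix.diagonal] <;> field_simp

/-- Entries of the action matrix of a matrix with entries `≤ 5` are `≤ C₁`. [folklore] -/
theorem abs_actionMatrix_le {γ : Matrix (Fin 2) (Fin 2) ℝ} (hγ : ∀ i j, |γ i j| ≤ 5) (i l : Fin 5) :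
    |actionMatrix γ i l| ≤ C₁ := by
  have h := C₁_spec γ (ofCoeffs (Pi.single l 1)) hγ ?_ i
  · rw [coeffs_subst, coeffs_ofCoeffs, Matrix.mulVec_single, MulOpposite.op_one, one_smul] at h
    simpa [Matrix.col] using h
  · intro l'
    rw [coeffs_ofCoeffs, Pi.single_apply]
    split_ifs <;> simp

/-- Coordinatewise bound: `|(A(γ) w)_i| ≤ 5 C₁ ‖w‖` for `|γᵢⱼ| ≤ 5`. [folklore] -/
theorem abs_actionMatrix_mulVec_le {γ : Matrix (Fin 2) (Fin 2) ℝ} (hγ : ∀ i j, |γ i j| ≤ 5) (w : Fin 5 → ℝ)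
    (i : Fin 5) : |(actionMatrix γ *ᵥ w) i| ≤ 5 * C₁ * ‖w‖ := by
  rw [Matrix.mulVec, dotProduct]
  calc |∑ l, actionMatrix γ i l * w l| ≤ ∑ l, |actionMatrix γ i l * w l| := Finset.abs_sum_le_sum_abs _ _
    _ ≤ ∑ _l : Fin 5, C₁ * ‖w‖ := by
        refine Finset.sum_le_sum fun l _ => ?_
        rw [abs_mul]
        exact mul_le_mul (abs_actionMatrix_le hγ i l) (by rw [← Real.norm_eq_abs]; exact norm_le_pi_norm w l)
          (abs_nonneg _) C₁_pos.le
    _ = 5 * C₁ * ‖w‖ := by simp [Finset.sum_const]; ring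

/-- The anisotropic weights `(y², y, 1, y⁻¹, y⁻²)`. [folklore] -/
def dWeight (y : ℝ) : Fin 5 → ℝ := ![y ^ 2, y, 1, y⁻¹, (y⁻¹) ^ 2]

/-- The weights are nonnegative. [folklore] -/
theorem dWeight_nonneg {y : ℝ} (hy : 0 ≤ y) (i : Fin 5) : 0 ≤ dWeight y i := by
  fin_cases i <;> simp [dWeight] <;> positivity

/-- The scale `Λ = 20 C₁ L X^{1/6}` of the Lipschitz constants. [folklore] -/
def Lam (X : ℝ) : ℝ := 20 * C₁ * Lmax D * X ^ (1 / 6 : ℝ)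

/-- `Λ > 0`. [folklore] -/
theorem Lam_pos {X : ℝ} (hX : 0 < X) : 0 < Lam D X := by
  unfold Lam; have := one_le_Lmax D; have := C₁_pos; have := Real.rpow_pos_of_pos hX (1 / 6 : ℝ); positivity

/-- **The patches are coordinatewise Lipschitz with constants `Λ · (y², y, 1, y⁻¹, y⁻²)`** for
`g = ñ(x) a(√y) k(θ)` with `|x| ≤ 1/2`, `y ≥ √3/2`. [folklore] -/
theorem patch_lipschitz {X : ℝ} (hX : 0 < X) {x y θ : ℝ} (hx : |x| ≤ 1 / 2) (hy : Real.sqrt 3 / 2 ≤ y)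
    (idx : PatchIdx K) {s : Fin 4 → ℝ} (hs : s ∈ Set.Icc (0 : Fin 4 → ℝ) 1) {s' : Fin 4 → ℝ}
    (hs' : s' ∈ Set.Icc (0 : Fin 4 → ℝ) 1) (i : Fin 5) :
    |patch D (iwasawaGinv x y θ) X idx s i - patch D (iwasawaGinv x y θ) X idx s' i| ≤
      Lam D X * dWeight y i * dist s s' := by
  obtain ⟨k, j, b⟩ := idx
  have hy0 : 0 < y := lt_of_lt_of_le (by positivity) hy
  have hsq : Real.sqrt y ≠ 0 := (Real.sqrt_pos.2 hy0).ne'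
  have h3 : (1 : ℝ) / 2 ≤ Real.sqrt 3 / 2 := by
    have : (1 : ℝ) ≤ Real.sqrt 3 := by
      rw [show (1:ℝ) = Real.sqrt 1 by simp]; exact Real.sqrt_le_sqrt (by norm_num)
    linarith
  have hxy : |x / y| ≤ 1 := by rw [abs_div, abs_of_pos hy0, div_le_one hy0]; linarith
  set γ₀ := upperShear (x / y) * rotR θ with hγ₀
  have hγ : ∀ i j, |γ₀ i j| ≤ 5 := by
    intro i j
    have := abs_mul_apply_le (abs_upperShear_le hxy) (abs_rotR_le θ) i j
    linarith
  set P := D k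
  set f := faceMap (boxLo P.t₁) (boxUp P.t₂) j (faceVal P j b) with hf
  set Δ := psi P.C.cone (f s) - psi P.C.cone (f s') with hΔ
  -- the difference of the patches
  have e : patch D (iwasawaGinv x y θ) X (k, j, b) s i - patch D (iwasawaGinv x y θ) X (k, j, b) s' i =
      X ^ (1 / 6 : ℝ) * ((actionMatrix (iwasawaGinv x y θ) *ᵥ Δ) i) := by
    simp only [patch, linT_apply, hΔ, Matrix.mulVec_sub, Pi.smul_apply, Pi.sub_apply, smul_eq_mul]
    ring
  rw [e, iwasawaGinv_eq_diagTorus_mul x hy0 θ, actionMatrix_mul, ← Matrix.mulVec_mulVec,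
    actionMatrix_diagTorus hsq, Matrix.mulVec_diagonal]
  have hsq2 : Real.sqrt y ^ 2 = y := Real.sq_sqrt hy0.le
  have hd : (![Real.sqrt y ^ 4, Real.sqrt y ^ 2, 1, (Real.sqrt y)⁻¹ ^ 2, (Real.sqrt y)⁻¹ ^ 4] : Fin 5 → ℝ) i = dWeight y i := by
    have hsq4 : Real.sqrt y ^ 4 = y ^ 2 := by rw [show (4:ℕ) = 2 * 2 from rfl, pow_mul, hsq2]
    fin_cases i <;> simp [dWeight, hsq4, hsq2, inv_pow]
  rw [hd, abs_mul, abs_mul, abs_of_nonneg (Real.rpow_nonneg hX.le _), abs_of_nonneg (dWeight_nonneg hy0.le i)]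
  -- `|(A(γ₀) Δ)_i| ≤ 5 C₁ ‖Δ‖ ≤ 5 C₁ L 4 dist`
  have hA := abs_actionMatrix_mulVec_le hγ Δ i
  have hΔn : ‖Δ‖ ≤ Lk P * (4 * dist s s') := by
    calc ‖Δ‖ ≤ Lk P * ‖f s - f s'‖ := Lk_spec P (faceMap_mem_Icc P j b hs) (faceMap_mem_Icc P j b hs')
      _ ≤ Lk P * (4 * dist s s') := by
          refine mul_le_mul_of_nonneg_left ?_ (Lk_nonneg P)
          rw [pi_norm_le_iff_of_nonneg (by positivity)]
          intro i'
          rw [Pi.sub_apply, Real.norm_eq_abs]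
          exact faceMap_lipschitz _ _ (abs_boxUp_sub_boxLo_le P.ht P.ht4) j _ s s' i'
  have hL := Lk_le_Lmax D k
  have hC := C₁_pos
  have hdn := dWeight_nonneg hy0.le i
  have hX6 := Real.rpow_nonneg hX.le (1 / 6 : ℝ)
  calc X ^ (1 / 6 : ℝ) * (dWeight y i * |(actionMatrix γ₀ *ᵥ Δ) i|)
      ≤ X ^ (1 / 6 : ℝ) * (dWeight y i * (5 * C₁ * (Lmax D * (4 * dist s s')))) := by
        gcongr
        calc |(actionMatrix γ₀ *ᵥ Δ) i| ≤ 5 * C₁ * ‖Δ‖ := hA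
          _ ≤ 5 * C₁ * (Lk P * (4 * dist s s')) := by gcongr
          _ ≤ 5 * C₁ * (Lmax D * (4 * dist s s')) := by gcongr
    _ = Lam D X * dWeight y i * dist s s' := by unfold Lam; ring

/-! ## The lattice-point count of `S_g` in the main body -/

/-- `det (ñ(x) a(√y) k(θ)) = 1`. [folklore] -/
theorem det_iwasawaGinv (x : ℝ) {y : ℝ} (hy : 0 < y) (θ : ℝ) : (iwasawaGinv x y θ).det = 1 := by
  rw [iwasawaGinv, Matrix.det_mul, Matrix.det_mul, det_upperShear_eq_one, det_diagTorus (Real.sqrt_pos.2 hy).ne',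
    det_rotR]; ring

/-- `S_g` is bounded. [folklore] -/
theorem isBounded_regionS_sections {X : ℝ} (hX : 0 < X) {x y θ : ℝ} (hx : |x| ≤ 1 / 2) (hy : Real.sqrt 3 / 2 ≤ y) :
    Bornology.IsBounded (regionS (sections D X) (iwasawaGinv x y θ)) := by
  rw [isBounded_iff_forall_norm_le]
  have hy0 : 0 < y := lt_of_lt_of_le (by positivity) hy
  set R := X ^ (1 / 6 : ℝ)
  refine ⟨C₁ * R * (y ^ 2 + y + 1 + y⁻¹ + (y⁻¹) ^ 2), fun v hv => ?_⟩
  obtain ⟨b0, b1, b2, b3, b4⟩ := regionS_coeff_bounds (Real.rpow_nonneg hX.le _)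
    (fun ℓ hℓ l => sections_coeff_le D hX.le hℓ l) hx hy hv
  have hCR : 0 ≤ C₁ * R := mul_nonneg C₁_pos.le (Real.rpow_nonneg hX.le _)
  rw [pi_norm_le_iff_of_nonneg (by positivity)]
  intro i
  rw [Real.norm_eq_abs]
  have hy1 : 0 ≤ y⁻¹ := by positivity
  fin_cases i <;> simp only [Fin.zero_eta, Fin.mk_one, Fin.reduceFinMk, Fin.isValue]
  · nlinarith [b0, mul_nonneg hCR hy0.le, mul_nonneg hCR hy1, mul_nonneg hCR (sq_nonneg y⁻¹)]
  · nlinarith [b1, mul_nonneg hCR (sq_nonneg y), mul_nonneg hCR hy1, mul_nonneg hCR (sq_nonneg y⁻¹)]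
  · nlinarith [b2, mul_nonneg hCR (sq_nonneg y), mul_nonneg hCR hy0.le, mul_nonneg hCR hy1, mul_nonneg hCR (sq_nonneg y⁻¹)]
  · nlinarith [b3, mul_nonneg hCR (sq_nonneg y), mul_nonneg hCR hy0.le, mul_nonneg hCR (sq_nonneg y⁻¹)]
  · nlinarith [b4, mul_nonneg hCR (sq_nonneg y), mul_nonneg hCR hy0.le, mul_nonneg hCR hy1]

/-- Powers of `y ≥ √3/2`. [folklore] -/
theorem pow_bounds_of_ge {y : ℝ} (hy : Real.sqrt 3 / 2 ≤ y) :
    2 / 3 ≤ y ∧ 2 / 3 ≤ y ^ 2 ∧ 1 / 2 ≤ y ^ 3 ∧ 1 / 2 ≤ y ^ 4 := by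
  have hs17 : (17 : ℝ) / 10 ≤ Real.sqrt 3 := by
    rw [show (17:ℝ)/10 = Real.sqrt ((17/10)^2) by rw [Real.sqrt_sq (by norm_num)]]
    exact Real.sqrt_le_sqrt (by norm_num)
  have hy1 : (17 : ℝ) / 20 ≤ y := by linarith
  have hy0 : 0 ≤ y := by linarith
  refine ⟨by linarith, by nlinarith, by nlinarith [mul_nonneg hy0 hy0], ?_⟩
  nlinarith [mul_nonneg (mul_nonneg hy0 hy0) hy0, mul_nonneg hy0 hy0]

/-- **The lattice-point count of `S_g` in the main body** (the tree's substitute for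
Bhargava–Shankar's use of Davenport's lemma, Prop. 2.6, on `B(n,t,λ,X)`): for `X ≥ 1`,
`g = ñ(x) a(√y) k(θ)` with `|x| ≤ ½`, `y ≥ √3/2` and `Λ y⁻² ≥ 1`,
`|#{z ∈ ℤ⁵ : z ∈ S_g} − X^{5/6} vol(B₁)| ≤ 576000 K Λ⁴ y²` with `Λ = 20 C₁ L X^{1/6}`, i.e. an error
`≪ X^{2/3} y²` (Bhargava–Shankar: `O(λ¹⁶ t²·…)`, display (13)). [cite: BhargavaShankarAnnals2015, §2.3 (Prop. 2.6 and displays (12)–(13); arXiv:1006.1002v2 numbering)] -/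
theorem abs_latticeCount_sub_le {X : ℝ} (hX : 1 ≤ X) {x y θ : ℝ} (hx : |x| ≤ 1 / 2) (hy : Real.sqrt 3 / 2 ≤ y)
    (hbody : 1 ≤ Lam D X * (y⁻¹) ^ 2) :
    |(({z : Fin 5 → ℤ | intPt z ∈ regionS (sections D X) (iwasawaGinv x y θ)}).ncard : ℝ) -
        X ^ (5 / 6 : ℝ) * volume.real (B1set D)| ≤ 576000 * K * Lam D X ^ 4 * y ^ 2 := by
  have hX0 : 0 < X := by linarith
  have hy0 : 0 < y := lt_of_lt_of_le (by positivity) hy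
  have hΛ := Lam_pos D hX0
  have hdet : (iwasawaGinv x y θ).det = 1 := det_iwasawaGinv x hy0 θ
  set g := iwasawaGinv x y θ with hg
  set Λ := Lam D X with hΛdef
  set n : ℕ := ⌈Λ * (y⁻¹) ^ 2⌉₊ with hn
  have hnpos : 0 < n := Nat.ceil_pos.2 (by positivity)
  -- the counting theorem
  have hmain := abs_ncard_sub_volume_le_of_forall_patch (isBounded_regionS_sections D hX0 hx hy)
    (P := PatchIdx K) (m := 4) (patch D g X) (fun _ i => Λ * dWeight y i)
    (fun _ i => mul_nonneg hΛ.le (dWeight_nonneg hy0.le i))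
    (fun idx s hs s' hs' i => patch_lipschitz D hX0 hx hy idx hs hs' i)
    (fun _ => n) (fun _ => hnpos)
    (frontier_regionS_subset D hX0 (by rw [hdet]; exact one_ne_zero))
  -- the volume
  have hvol : volume.real (regionS (sections D X) g) = X ^ (5 / 6 : ℝ) * volume.real (B1set D) := by
    rw [Measure.real, regionS_sections_eq D hX0, volume_linT_image hdet hX0.le, ENNReal.toReal_mul,
      ENNReal.toReal_ofReal (Real.rpow_nonneg hX0.le _), Measure.real]
  rw [hvol] at hmain
  refine hmain.trans ?_
  -- the arithmetic
  rw [Finset.sum_const, Finset.card_univ, nsmul_eq_mul]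
  have hcard : (Fintype.card (PatchIdx K) : ℝ) = 10 * K := by
    simp [PatchIdx, Fintype.card_prod, Fintype.card_fin, Fintype.card_bool]; ring
  rw [hcard]
  obtain ⟨p1, p2, p3, p4⟩ := pow_bounds_of_ge hy
  have hnR : Λ * (y⁻¹) ^ 2 ≤ (n : ℝ) := Nat.le_ceil _
  have hnR' : (n : ℝ) ≤ 2 * (Λ * (y⁻¹) ^ 2) := by
    have := Nat.ceil_lt_add_one (by positivity : (0:ℝ) ≤ Λ * (y⁻¹) ^ 2)
    rw [← hn] at this; linarith
  have hnpos' : (0 : ℝ) < n := by exact_mod_cast hnpos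
  -- each factor `2 Λ dᵢ / n + 2 ≤ 2 dᵢ y² + 2`
  have hfac : ∀ i, 2 * (Λ * dWeight y i) / n + 2 ≤ 2 * (dWeight y i * y ^ 2) + 2 := by
    intro i
    have h1 : 2 * (Λ * dWeight y i) / n ≤ 2 * (Λ * dWeight y i) / (Λ * (y⁻¹) ^ 2) :=
      div_le_div_of_nonneg_left (by have := dWeight_nonneg hy0.le i; positivity) (by positivity) hnR
    have h2 : 2 * (Λ * dWeight y i) / (Λ * (y⁻¹) ^ 2) = 2 * (dWeight y i * y ^ 2) := by
      field_simp
    linarith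
  rw [Fin.prod_univ_five]
  have d0 : dWeight y 0 * y ^ 2 = y ^ 4 := by simp [dWeight]; ring
  have d1 : dWeight y 1 * y ^ 2 = y ^ 3 := by simp [dWeight]; ring
  have d2 : dWeight y 2 * y ^ 2 = y ^ 2 := by simp [dWeight]
  have d3 : dWeight y 3 * y ^ 2 = y := by simp [dWeight]; field_simp
  have d4 : dWeight y 4 * y ^ 2 = 1 := by simp [dWeight]; field_simp
  have f0 := hfac 0; have f1 := hfac 1; have f2 := hfac 2; have f3 := hfac 3; have f4 := hfac 4
  rw [d0] at f0; rw [d1] at f1; rw [d2] at f2; rw [d3] at f3; rw [d4] at f4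
  have g0 : 2 * (Λ * dWeight y 0) / n + 2 ≤ 6 * y ^ 4 := by linarith
  have g1 : 2 * (Λ * dWeight y 1) / n + 2 ≤ 6 * y ^ 3 := by linarith
  have g2 : 2 * (Λ * dWeight y 2) / n + 2 ≤ 5 * y ^ 2 := by linarith
  have g3 : 2 * (Λ * dWeight y 3) / n + 2 ≤ 5 * y := by linarith
  have g4 : 2 * (Λ * dWeight y 4) / n + 2 ≤ 4 := by linarith
  have pos : ∀ i, 0 ≤ 2 * (Λ * dWeight y i) / n + 2 := fun i => by
    have := dWeight_nonneg hy0.le i; positivity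
  have hprod : (2 * (Λ * dWeight y 0) / n + 2) * (2 * (Λ * dWeight y 1) / n + 2) * (2 * (Λ * dWeight y 2) / n + 2) *
      (2 * (Λ * dWeight y 3) / n + 2) * (2 * (Λ * dWeight y 4) / n + 2) ≤
      6 * y ^ 4 * (6 * y ^ 3) * (5 * y ^ 2) * (5 * y) * 4 := by
    have m01 := mul_le_mul g0 g1 (pos 1) (by positivity)
    have m012 := mul_le_mul m01 g2 (pos 2) (by positivity)
    have m0123 := mul_le_mul m012 g3 (pos 3) (by positivity)
    exact mul_le_mul m0123 g4 (pos 4) (by positivity)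
  have hn4 : (n : ℝ) ^ 4 ≤ (2 * (Λ * (y⁻¹) ^ 2)) ^ 4 := pow_le_pow_left₀ hnpos'.le hnR' 4
  have hprodnn : 0 ≤ (2 * (Λ * dWeight y 0) / n + 2) * (2 * (Λ * dWeight y 1) / n + 2) * (2 * (Λ * dWeight y 2) / n + 2) *
      (2 * (Λ * dWeight y 3) / n + 2) * (2 * (Λ * dWeight y 4) / n + 2) := by
    have := pos 0; have := pos 1; have := pos 2; have := pos 3; have := pos 4; positivity
  have hK : (0 : ℝ) ≤ 10 * K := by positivity
  calc 10 * (K : ℝ) * ((n : ℝ) ^ 4 * ((2 * (Λ * dWeight y 0) / n + 2) * (2 * (Λ * dWeight y 1) / n + 2) *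
        (2 * (Λ * dWeight y 2) / n + 2) * (2 * (Λ * dWeight y 3) / n + 2) * (2 * (Λ * dWeight y 4) / n + 2)))
      ≤ 10 * K * ((2 * (Λ * (y⁻¹) ^ 2)) ^ 4 * (6 * y ^ 4 * (6 * y ^ 3) * (5 * y ^ 2) * (5 * y) * 4)) := by
        apply mul_le_mul_of_nonneg_left _ hK
        exact mul_le_mul hn4 hprod hprodnn (by positivity)
    _ = 576000 * K * Λ ^ 4 * y ^ 2 := by field_simp; ring

end BinaryQuartic

end Literature.NumberTheory.EllipticCurves

end
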